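import Summits.AtomisticToContinuum.Crystallization.Theorems.PalmUnimodularRigidityLayeredLawsSelectHcpBallPositions

/-!
# Crux `LayeredLawsSelectHcp` (stmt-AtomisticToContinuum-9226), line `mtp-prestress-split-ergodic-frame`:
# the one-star frame at ANY label pins the graph ball of radius `2` around it (`stub_chartCubeFrames`, T3)

Registered sub-goal `stub_chartCubeFrames` (T3 of the threshold-interpolation assembly of the bulk co-Lipschitz
ranges, lead c4).  For a rooted labelled chart `X` of an every-point-good hcp-charted `S` and EVERY label `c` (not just
the root) there is a frame `(a, A)`, `a ∈ [9/10, 1]`, with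
`‖X (labelShift c u) − X c − a • A (Pᵢ (labelShift c u) − Pᵢ c)‖ ≤ (758/10000) a` for all `u ∈ ballLabels 2`
(`Pᵢ = hcpSite 1 √(2/3)`).  This is re-rooting bookkeeping on top of the landed root statement:

* the re-rooted chart `reRoot X c` (`reRoot X c u = X (labelShift c u) − X c`) is a rooted chart of the translated
  configuration `S − X c` (`tube_reRoot_isRootedChart`), which is again every-point-good and hcp-charted
  (`good_image_sub`); `exists_frame_reRoot` gives its one-star frame `(a, A)` and `ball_positions_le` (`n = 2`,
  `2a/100 + 2 · 251/10000 ≤ (758/10000) a` for `a ≥ 9/10`) the bound `‖reRoot X c u − a • A (Pᵢ u)‖ ≤ (758/10000) a`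
  on `ballLabels 2`;
* `Pᵢ (labelShift c u) − Pᵢ c = σ_c • Pᵢ u`, `σ_c = ±1` the parity sign of the layer of `c` (`hcpSite_labelShift`); for
  even layers the frame is `(a, A)`, for odd layers the sign is absorbed into the isometry, `(a, A ∘ (−1))`
  (`LinearIsometryEquiv.neg`).

All `[folklore]`.
-/

noncomputable section

namespace Summit.AtomisticToContinuum.Crystallization.Theorems.PalmUnimodularRigidity.LayeredLawsSelectHcp

open MeasureTheory Set
open Literature.MathematicalPhysics.StatisticalMechanics Literature.Geometry.DiscreteGeometry
open Summit.AtomisticToContinuum.Crystallization.Theorems.LayeredLawsSelectHcp.Negative.DiracLaws (GoodShell)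

/-- **The re-rooted graph ball of radius `2` is pinned to the re-rooted one-star frame.**  For every label `c` of a
rooted labelled chart `X` of an every-point-good hcp-charted `S` there is a frame `(a, A)`, `a ∈ [9/10, 1]`, fitting the
star of `reRoot X c` within `a/100` and with `‖reRoot X c u − a • A (Pᵢ u)‖ ≤ (758/10000) a` on `ballLabels 2`
(`exists_frame_reRoot`, then `ball_positions_le` with `n = 2` for the translated configuration `S − X c`,
`good_image_sub`, `tube_reRoot_isRootedChart`). [folklore] -/
theorem exists_frame_reRoot_ball_two {S : Set (EuclideanSpace ℝ (Fin 3))} (hgood : ∀ x ∈ S, GoodShell S x)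
    (hch : HcpCharted S) {X : ℤ × ℤ × ℤ → EuclideanSpace ℝ (Fin 3)} (hX : IsRootedChart S X) (c : ℤ × ℤ × ℤ) :
    ∃ a : ℝ, 9 / 10 ≤ a ∧ a ≤ 1 ∧ ∃ A : EuclideanSpace ℝ (Fin 3) ≃ₗᵢ[ℝ] EuclideanSpace ℝ (Fin 3),
      (∀ v ∈ hcpStarIdx, ‖reRoot X c v - a • A (hcpSite 1 (Real.sqrt (2 / 3)) v)‖ ≤ a / 100) ∧
      ∀ u ∈ ballLabels 2, ‖reRoot X c u - a • A (hcpSite 1 (Real.sqrt (2 / 3)) u)‖ ≤ 758 / 10000 * a := by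
  obtain ⟨-, hg', hch'⟩ := good_image_sub hgood hch (hX.2.1 c)
  have hXc := tube_reRoot_isRootedChart S X hX c
  obtain ⟨a, h9, h1, A, hA⟩ := exists_frame_reRoot hgood hch hX c
  exact ⟨a, h9, h1, A, hA,
    ball_positions_le hg' hch' hXc h9 h1 hA 2 (C := 758 / 10000) (by push_cast; linarith)⟩

/-- **The ideal bond read through the label transport**: `Pᵢ (labelShift c u) − Pᵢ c = σ_c • Pᵢ u`, `σ_c` the parity
sign of the layer of `c` (`hcpSite_labelShift`). [folklore] -/
theorem hcpSite_labelShift_sub (a h : ℝ) (c u : ℤ × ℤ × ℤ) :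
    hcpSite a h (labelShift c u) - hcpSite a h c = (if Even c.1 then (1 : ℝ) else -1) • hcpSite a h u := by
  rw [hcpSite_labelShift a h c u, add_sub_cancel_left]

/-- **Registered sub-goal `stub_chartCubeFrames` (T3): the one-star frame at ANY label pins the graph ball of radius
`2` around it.**  For a rooted labelled chart `X` of an every-point-good hcp-charted `S` and every label `c` there is a
frame `(a, A)`, `a ∈ [9/10, 1]`, with `‖X (labelShift c u) − X c − a • A (Pᵢ (labelShift c u) − Pᵢ c)‖ ≤ (758/10000) a`
for all `u ∈ ballLabels 2` (`Pᵢ = hcpSite 1 √(2/3)`): the re-rooted chart `reRoot X c` is a rooted chart of the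
translated configuration (`tube_reRoot_isRootedChart`, `good_image_sub`), `exists_frame_reRoot` gives its one-star
frame and `ball_positions_le` (`n = 2`) the bound `‖reRoot X c u − a • A (Pᵢ u)‖ ≤ c₂ a`
(`exists_frame_reRoot_ball_two`); finally `Pᵢ (labelShift c u) − Pᵢ c = ± Pᵢ u` (`hcpSite_labelShift_sub`), the
sign absorbed into `A` for odd layers (`A ∘ (−1)` is a linear isometry, `LinearIsometryEquiv.neg`). [folklore] -/
theorem stub_chartCubeFrames :
    ∀ S : Set (EuclideanSpace ℝ (Fin 3)), (∀ x ∈ S, GoodShell S x) → HcpCharted S →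
      ∀ X : ℤ × ℤ × ℤ → EuclideanSpace ℝ (Fin 3), IsRootedChart S X → ∀ c : ℤ × ℤ × ℤ,
        ∃ a : ℝ, 9 / 10 ≤ a ∧ a ≤ 1 ∧ ∃ A : EuclideanSpace ℝ (Fin 3) ≃ₗᵢ[ℝ] EuclideanSpace ℝ (Fin 3),
          ∀ u ∈ ballLabels 2,
            ‖X (labelShift c u) - X c -
                a • A (hcpSite 1 (Real.sqrt (2 / 3)) (labelShift c u) - hcpSite 1 (Real.sqrt (2 / 3)) c)‖ ≤
              758 / 10000 * a := by
  intro S hgood hch X hX c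
  obtain ⟨a, h9, h1, A, -, hball⟩ := exists_frame_reRoot_ball_two hgood hch hX c
  by_cases hc : Even c.1
  · refine ⟨a, h9, h1, A, fun u hu => ?_⟩
    have h := hball u hu
    rw [hcpSite_labelShift_sub, if_pos hc, one_smul]
    exact h
  · refine ⟨a, h9, h1, (LinearIsometryEquiv.neg ℝ).trans A, fun u hu => ?_⟩
    have h := hball u hu
    have e : ((LinearIsometryEquiv.neg ℝ).trans A) ((-1 : ℝ) • hcpSite 1 (Real.sqrt (2 / 3)) u) =
        A (hcpSite 1 (Real.sqrt (2 / 3)) u) := by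
      rw [LinearIsometryEquiv.trans_apply, neg_smul, one_smul]
      exact congrArg A (neg_neg _)
    rw [hcpSite_labelShift_sub, if_neg hc, e]
    exact h

end Summit.AtomisticToContinuum.Crystallization.Theorems.PalmUnimodularRigidity.LayeredLawsSelectHcp

end
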